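import Summits.ABC.ABC.Theses.IneffectiveSubspace

/-!
# `UniformSadicTowerFour` (stmt-ABC-14937), line `flat-steep-split`: `ε` cannot be dropped on the boundary cell `θ = 1`

The boundary `θ = 1` of the heavy child of the crux is the uniform prime-power cell at level four
(`HeavyPlaces.heavyAtOne_iff_primePowerCell`):
`∀ ε > 0 ∃ C ∀ p prime ∀ coprime positive a + b = p^k : p^k < C · (p · rad₄(ab))^(1+ε)`.
This file shows, unconditionally and elementarily, that its `ε = 0` version is FALSE
(`primePowerCell_noEps_false`): on the family `1 + (3^(2^n) − 1) = 3^(2^n)` one has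
`2^(n+2) ∣ 3^(2^n) − 1` (`two_pow_dvd_three_pow_sub_one`), and a number divisible by `2^(4j)` has
`8^j · rad₄ ≤` itself (`pow_mul_rad4_le`), so `p · rad₄(ab) = 3 · rad₄(3^(2^n) − 1) ≤ 3 · 3^(2^n) / 8^j`
is smaller than `c = 3^(2^n)` by an unbounded factor.  (The gain is `≍ log log c`, so this does not touch
the `ε > 0` statement; it records that `EpsilonCannotBeDropped` bites the heavy child already on its
mildest non-vacuous cell — the disprover's `Negative.NoEps` concerned the `K = 0` face, which the heavy
child excludes.)
-/

-- `Summit.<Summit>.<Problem>` is the mandated summit-side namespace (CONVENTIONS §2); for the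
-- single-conjunct summit `ABC` the two coincide, so the duplicate `ABC.ABC` is deliberate.
set_option linter.dupNamespace false

namespace Summit.ABC.ABC.Theorems.UniformSadicTowerFour.HeavyPlaces

open Literature.NumberTheory.DiophantineGeometry (IsABCTriple)
open scoped BigOperators

/-- `2^(n+2) ∣ 3^(2^n) − 1` for `n ≥ 1` (lifting the exponent at `2`, by induction:
`3^(2^(n+1)) − 1 = (3^(2^n) − 1)(3^(2^n) + 1)` with the second factor even). [folklore] -/
theorem two_pow_dvd_three_pow_sub_one (n : ℕ) (hn : 1 ≤ n) : 2 ^ (n + 2) ∣ 3 ^ (2 ^ n) - 1 := by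
  induction n, hn using Nat.le_induction with
  | base => decide
  | succ n hn ih =>
    have hsq : 3 ^ (2 ^ (n + 1)) - 1 = (3 ^ (2 ^ n) + 1) * (3 ^ (2 ^ n) - 1) := by
      rw [pow_succ, pow_mul, ← Nat.sq_sub_sq, one_pow]
    have heven : 2 ∣ 3 ^ (2 ^ n) + 1 := by
      have : Odd (3 ^ (2 ^ n)) := Odd.pow (by decide)
      exact (this.add_one).two_dvd
    rw [hsq, show n + 1 + 2 = (n + 2) + 1 by ring, pow_succ']
    exact mul_dvd_mul heven ih

/-- If `2^(4j) ∣ b` then `8^j · rad₄(b) ≤ b`, `rad₄(b) = ∏_{q ∣ b} q^⌈v_q(b)/4⌉`: the prime `2` is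
charged `2^⌈e/4⌉` for a block `2^e`, `e ≥ 4j`. [folklore] -/
theorem pow_mul_rad4_le {b j : ℕ} (hb : b ≠ 0) (hj : 1 ≤ j) (hdvd : 2 ^ (4 * j) ∣ b) :
    2 ^ (3 * j) * ∏ q ∈ b.primeFactors, q ^ ((b.factorization q + 3) / 4) ≤ b := by
  set e := b.factorization 2 with he
  have hej : 4 * j ≤ e := (Nat.prime_two.pow_dvd_iff_le_factorization hb).mp hdvd
  have h2mem : 2 ∈ b.primeFactors :=
    Nat.mem_primeFactors.mpr ⟨Nat.prime_two, (dvd_pow_self 2 (by omega)).trans hdvd, hb⟩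
  -- split both the rounded and the full product at the prime 2
  have hsplit := Finset.mul_prod_erase b.primeFactors (fun q => q ^ ((b.factorization q + 3) / 4)) h2mem
  have hfull : 2 ^ e * ∏ q ∈ b.primeFactors.erase 2, q ^ b.factorization q = b := by
    have h := Finset.mul_prod_erase b.primeFactors (fun q => q ^ b.factorization q) h2mem
    rw [h]
    have := Nat.prod_factorization_pow_eq_self hb
    rwa [Finsupp.prod, Nat.support_factorization] at this
  -- rounded ≤ full away from 2
  have hround : ∏ q ∈ b.primeFactors.erase 2, q ^ ((b.factorization q + 3) / 4) ≤
      ∏ q ∈ b.primeFactors.erase 2, q ^ b.factorization q := by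
    refine Finset.prod_le_prod' fun q hq => ?_
    have hqb := Nat.mem_primeFactors.mp (Finset.mem_of_mem_erase hq)
    have hv : 0 < b.factorization q := hqb.1.factorization_pos_of_dvd hb hqb.2.1
    exact Nat.pow_le_pow_right hqb.1.pos (by omega)
  have hexp : 3 * j + (e + 3) / 4 ≤ e := by omega
  calc 2 ^ (3 * j) * ∏ q ∈ b.primeFactors, q ^ ((b.factorization q + 3) / 4)
      = 2 ^ (3 * j + (e + 3) / 4) *
          ∏ q ∈ b.primeFactors.erase 2, q ^ ((b.factorization q + 3) / 4) := by
        rw [← hsplit, pow_add, mul_assoc]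
    _ ≤ 2 ^ e * ∏ q ∈ b.primeFactors.erase 2, q ^ b.factorization q :=
        Nat.mul_le_mul (Nat.pow_le_pow_right (by norm_num) hexp) hround
    _ = b := hfull

/-- **`ε` cannot be dropped on the uniform prime-power cell at level four**: there is no `C` with
`p^k < C · p · rad₄(ab)` for all primes `p` and coprime positive `a + b = p^k`.  Witness family:
`p = 3`, `a = 1`, `b = 3^(2^n) − 1`, `n = 4j − 2`. [folklore] -/
theorem primePowerCell_noEps_false :
    ¬ ∃ C : ℝ, ∀ p a b k : ℕ, p.Prime → IsABCTriple a b (p ^ k) →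
      ((p ^ k : ℕ) : ℝ) < C * ((p * ∏ q ∈ (a * b).primeFactors,
        q ^ (((a * b).factorization q + 3) / 4) : ℕ) : ℝ) := by
  rintro ⟨C, hC⟩
  -- choose j with 3C ≤ 8^j
  obtain ⟨j, hj⟩ := exists_nat_gt (3 * C)
  have hj1 : 1 ≤ j + 1 := by omega
  set J := j + 1 with hJ
  have h8 : 3 * C ≤ (2 : ℝ) ^ (3 * J) := by
    have h1 : (j : ℝ) ≤ J := by rw [hJ]; push_cast; linarith
    have h2 : (J : ℝ) ≤ (2 : ℝ) ^ (3 * J) := by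
      have := Nat.lt_pow_self (show 1 < 2 ^ 3 by norm_num) (n := J)
      rw [← pow_mul] at this
      exact_mod_cast this.le
    linarith
  -- the witness
  set n := 4 * J - 2 with hn
  have hn1 : 1 ≤ n := by omega
  set k := 2 ^ n with hk
  set b := 3 ^ k - 1 with hbdef
  have hk1 : 1 ≤ k := Nat.one_le_two_pow
  have h3k : 2 ≤ 3 ^ k := by
    calc 2 ≤ 3 ^ 1 := by norm_num
      _ ≤ 3 ^ k := Nat.pow_le_pow_right (by norm_num) hk1
  have hb0 : b ≠ 0 := by omega
  have habc : IsABCTriple 1 b (3 ^ k) :=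
    ⟨one_pos, by omega, by omega, Nat.coprime_one_left b⟩
  have hdvd : 2 ^ (4 * J) ∣ b := by
    have := two_pow_dvd_three_pow_sub_one n hn1
    rwa [show n + 2 = 4 * J by omega] at this
  have hrad := pow_mul_rad4_le hb0 hj1 hdvd
  -- the cell inequality at the witness
  have key := hC 3 1 b k Nat.prime_three habc
  rw [one_mul] at key
  -- `C * (3 * rad₄ b) ≤ 8^J * rad₄ b ≤ b < 3^k`
  have hradR : (2 : ℝ) ^ (3 * J) * ((∏ q ∈ b.primeFactors, q ^ ((b.factorization q + 3) / 4) : ℕ) : ℝ)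
      ≤ b := by exact_mod_cast hrad
  have hR0 : (0 : ℝ) ≤ ((∏ q ∈ b.primeFactors, q ^ ((b.factorization q + 3) / 4) : ℕ) : ℝ) :=
    Nat.cast_nonneg _
  have hlt : (b : ℝ) < ((3 ^ k : ℕ) : ℝ) := by exact_mod_cast (show b < 3 ^ k by omega)
  have : ((3 ^ k : ℕ) : ℝ) ≤ b := by
    calc ((3 ^ k : ℕ) : ℝ)
        ≤ C * ((3 * ∏ q ∈ b.primeFactors, q ^ ((b.factorization q + 3) / 4) : ℕ) : ℝ) := key.le
      _ = 3 * C * ((∏ q ∈ b.primeFactors, q ^ ((b.factorization q + 3) / 4) : ℕ) : ℝ) := by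
          push_cast; ring
      _ ≤ (2 : ℝ) ^ (3 * J) * ((∏ q ∈ b.primeFactors, q ^ ((b.factorization q + 3) / 4) : ℕ) : ℝ) :=
          mul_le_mul_of_nonneg_right h8 hR0
      _ ≤ b := hradR
  linarith

end Summit.ABC.ABC.Theorems.UniformSadicTowerFour.HeavyPlaces
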